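import Mathlib.AlgebraicGeometry.IdealSheaf.Basic
import Mathlib.RingTheory.RegularLocalRing.Defs
import HarnessLib

/-!
# Strict normal crossings divisors (de Jong 1996, 2.4; Stacks 0BI9)

Topic: `Literature/AlgebraicGeometry/Resolution`. The notion needed to state conclusion (ii) of
de Jong's alteration theorem (de Jong 1996, Thm. 4.1: the boundary `j₁(φ₁⁻¹(Z)) ∪ X̄₁ ∖ j₁(X₁)`
is a strict normal crossings divisor in the regular projective compactification `X̄₁`) and the
boundary conditions of semi-stable reduction statements (loc. cit. 3.1, 4.23, 6.3–6.5).

## The printed definitions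

* de Jong 1996, 2.4 (global form): "Let `S` be a Noetherian scheme. Let `D ⊂ S` be a divisor
  [2.3: a closed subscheme regularly embedded of codimension 1, i.e. an effective Cartier divisor]
  and let `Dᵢ ⊂ D`, `i ∈ I` be its irreducible components. We say that `D` is a *strict normal
  crossings divisor* in `S` if a) for any `s ∈ D` the local ring `𝒪_{S,s}` is regular, b) `D` is
  a reduced scheme, i.e. `D = ⋃ Dᵢ` scheme-theoretically, and c) for any nonempty `J ⊂ I` the
  closed subscheme `D_J = ⋂_{i ∈ J} Dᵢ` is a regular scheme of codimension `#J` in `S`."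
* Stacks Project, Tag 0BI9 (local form): "Let `X` be a locally Noetherian scheme. A *strict
  normal crossings divisor* on `X` is an effective Cartier divisor `D ⊂ X` such that for every
  `p ∈ D` the local ring `𝒪_{X,p}` is regular and there exists a regular system of parameters
  `x₁, …, x_d ∈ 𝔪_p` and `1 ≤ r ≤ d` such that `D` is cut out by `x₁ ⋯ x_r` in `𝒪_{X,p}`."
  Tag 0BIA proves the two forms equivalent for `X` locally Noetherian (there (2) = de Jong's
  a)–c) together with "each `Dᵢ` is an effective Cartier divisor", automatic under a)).

## Rendering

De Jong applies the notion to closed *subsets* (Thm. 4.1 (ii): "the closed subset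
`j₁(φ₁⁻¹(Z)) ∪ X̄₁ ∖ j₁(X₁)` is a strict normal crossings divisor in `X̄₁`"), a closed subset
being identified with the reduced closed subscheme it carries (loc. cit. 2.2). Accordingly
`IsStrictNormalCrossingsDivisor X Z` is a predicate on a subset `Z` of a scheme `X`: `Z` is
closed and, at every point `p ∈ Z`, the local form of Tag 0BI9 holds for the ideal of germs of
functions vanishing on `Z`, i.e. for the stalk `(I_Z)_p ⊆ 𝒪_{X,p}` of Mathlib's vanishing ideal
sheaf `I_Z = Scheme.IdealSheafData.vanishingIdeal Z` — the ideal sheaf of the reduced induced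
structure on `Z` (Stacks, Tag 01J3). As Mathlib's ideal sheaves have no stalks, the stalk is
written, as in Mathlib's `IsAffineOpen.mem_ideal_iff`, as the extension `I_Z(U) · 𝒪_{X,p}` of
`I_Z(U)` along `Γ(X, U) → 𝒪_{X,p}` for the affine open neighbourhoods `U` of `p` (all of which
give the same ideal since `I(D(f)) = I(U)_f`; this is `Literature.AlgGeom.stalkIdeal I_Z p` of
`MarkedIdeals.lean`, see `stalkIdeal_eq_map_germ` there). A regular system of parameters of the
regular local ring `𝒪_{X,p}` is a family of `d = dim 𝒪_{X,p}` generators of `𝔪_p`; it is split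
as `(x₁,…,x_r ; y₁,…,y_e)`, `r + e = d`, so that "cut out by `x₁ ⋯ x_r`" reads
`(I_Z)_p = (x₁ ⋯ x_r)`.
For `X` locally Noetherian this is equivalent to "the reduced closed subscheme `Z` is a strict
normal crossings divisor" in the sense of Tag 0BI9: the local condition forces the (coherent,
radical) ideal sheaf of `Z` to be invertible — its stalk at `p ∈ Z` is generated by the single
non-zero-divisor `x₁ ⋯ x_r` (a regular local ring is a domain, Tag 00NP) and it is `𝒪_{X,p}`
off `Z` — so `Z` is an effective Cartier divisor; conversely a strict normal crossings divisor is
reduced (Tag 0BIA), hence equal to the reduced structure on its support. No Noetherian hypothesis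
is built into the predicate; all sources use it on (locally) Noetherian schemes only.
(`Literature.AlgebraicGeometry.Resolution.HasSNC` in `MarkedIdeals.lean` is the different, list-indexed notion of BGMW 2011:
an ordered collection of regular divisors crossing normally, as used by resolution algorithms.)

## Content

* `IsStrictNormalCrossingsDivisor X Z` and the API `isClosed`, `isRegularLocalRing`,
  `exists_regularSystemOfParameters`, `empty`/`of_eq_empty` (the empty divisor), `_iff`.
  Imports are Mathlib-only.

## Sources

* A. J. de Jong, *Smoothness, semi-stability and alterations*, Publ. Math. IHÉS 83 (1996),
  2.2–2.4 (pdf pp. 5–6 = printed pp. 54–55), Thm. 4.1 p. 66.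
* The Stacks Project, Tags 0BI9, 0BIA (strict normal crossings), 00NP (regular local rings are
  domains), 01J3 (reduced induced closed subscheme).
-/

noncomputable section

open CategoryTheory AlgebraicGeometry TopologicalSpace IsLocalRing

universe u

namespace Literature.AlgebraicGeometry.Resolution

open Scheme.IdealSheafData

variable {X : Scheme.{u}}

/-- **Strict normal crossings divisor** (de Jong 1996, 2.4; Stacks, Tag 0BI9, local form), as a
predicate on a subset `Z` of a scheme `X` carrying its reduced induced structure (de Jong 1996,
2.2): `Z` is closed and for every point `p ∈ Z` the local ring `𝒪_{X,p}` is regular and admits a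
regular system of parameters `x₁, …, x_r, y₁, …, y_e` (`r + e = dim 𝒪_{X,p}` generators of the
maximal ideal) with `r ≥ 1` such that the ideal of germs of functions vanishing on `Z` is
`(I_Z)_p = (x₁ ⋯ x_r)`, i.e. `Z` is cut out by `x₁ ⋯ x_r` in `𝒪_{X,p}`; here
`I_Z = vanishingIdeal Z` is the ideal sheaf of the reduced structure on `Z`, its stalk is written
as the extension of `I_Z(U)` to `𝒪_{X,p}` for every affine open `U ∋ p` (independent of `U`),
and `closure Z = Z` feeds Mathlib's `vanishingIdeal`, which takes a closed set.
For `X` locally Noetherian this says exactly that the reduced closed subscheme `Z ⊂ X` is a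
strict normal crossings divisor in the sense of Tag 0BI9 (it is then automatically an effective
Cartier divisor), equivalently (Tag 0BIA) in the sense of de Jong 1996, 2.4.
[cite: DeJong1996, 2.4, p. 55] -/
def IsStrictNormalCrossingsDivisor (X : Scheme.{u}) (Z : Set X) : Prop :=
  IsClosed Z ∧ ∀ p ∈ Z,
    IsRegularLocalRing (X.presheaf.stalk p) ∧
    ∃ (r e : ℕ) (x : Fin r → X.presheaf.stalk p) (y : Fin e → X.presheaf.stalk p),
      1 ≤ r ∧ ringKrullDim (X.presheaf.stalk p) = (r + e : ℕ) ∧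
      Ideal.span (Set.range x ∪ Set.range y) = maximalIdeal (X.presheaf.stalk p) ∧
      ∀ (U : X.affineOpens) (hU : p ∈ (U : X.Opens)),
        ((vanishingIdeal ⟨closure Z, isClosed_closure⟩).ideal U).map
          (X.presheaf.germ U p hU).hom = Ideal.span {∏ i, x i}

namespace IsStrictNormalCrossingsDivisor

variable {Z : Set X}

/-- A strict normal crossings divisor is a closed subset. [folklore] -/
theorem isClosed (h : IsStrictNormalCrossingsDivisor X Z) : IsClosed Z :=
  h.1

/-- The ambient scheme is regular at every point of a strict normal crossings divisor
(de Jong 1996, 2.4 a)). [cite: DeJong1996, 2.4, p. 55] -/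
theorem isRegularLocalRing (h : IsStrictNormalCrossingsDivisor X Z) {p : X} (hp : p ∈ Z) :
    IsRegularLocalRing (X.presheaf.stalk p) :=
  (h.2 p hp).1

/-- The local description at a point of a strict normal crossings divisor: a regular system of
parameters `x₁,…,x_r,y₁,…,y_e` of `𝒪_{X,p}` with `Z` cut out by `x₁ ⋯ x_r`, `r ≥ 1`
(Stacks, Tag 0BI9). [folklore] -/
theorem exists_regularSystemOfParameters (h : IsStrictNormalCrossingsDivisor X Z) {p : X}
    (hp : p ∈ Z) :
    ∃ (r e : ℕ) (x : Fin r → X.presheaf.stalk p) (y : Fin e → X.presheaf.stalk p),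
      1 ≤ r ∧ ringKrullDim (X.presheaf.stalk p) = (r + e : ℕ) ∧
      Ideal.span (Set.range x ∪ Set.range y) = maximalIdeal (X.presheaf.stalk p) ∧
      ∀ (U : X.affineOpens) (hU : p ∈ (U : X.Opens)),
        ((vanishingIdeal ⟨closure Z, isClosed_closure⟩).ideal U).map
          (X.presheaf.germ U p hU).hom = Ideal.span {∏ i, x i} :=
  (h.2 p hp).2

/-- The empty subset is a strict normal crossings divisor (the empty divisor: the local
conditions are vacuous). [folklore] -/
theorem empty (X : Scheme.{u}) : IsStrictNormalCrossingsDivisor X (∅ : Set X) :=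
  ⟨isClosed_empty, fun _ hp => hp.elim⟩

/-- A subset with no points is a strict normal crossings divisor. [folklore] -/
theorem of_eq_empty (h : Z = ∅) : IsStrictNormalCrossingsDivisor X Z := by
  subst h
  exact empty X

end IsStrictNormalCrossingsDivisor

/-- Unfolding lemma for `IsStrictNormalCrossingsDivisor`. [folklore] -/
theorem isStrictNormalCrossingsDivisor_iff (X : Scheme.{u}) (Z : Set X) :
    IsStrictNormalCrossingsDivisor X Z ↔ IsClosed Z ∧ ∀ p ∈ Z,
      IsRegularLocalRing (X.presheaf.stalk p) ∧
      ∃ (r e : ℕ) (x : Fin r → X.presheaf.stalk p) (y : Fin e → X.presheaf.stalk p),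
        1 ≤ r ∧ ringKrullDim (X.presheaf.stalk p) = (r + e : ℕ) ∧
        Ideal.span (Set.range x ∪ Set.range y) = maximalIdeal (X.presheaf.stalk p) ∧
        ∀ (U : X.affineOpens) (hU : p ∈ (U : X.Opens)),
          ((vanishingIdeal ⟨closure Z, isClosed_closure⟩).ideal U).map
            (X.presheaf.germ U p hU).hom = Ideal.span {∏ i, x i} :=
  Iff.rfl

end Literature.AlgebraicGeometry.Resolution

end
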